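import Summits.ValiantsHypothesis.ValiantsHypothesis.Theorems.BarrierLeverAnchoredDoorHitsLowerPairsReenum
import Summits.ValiantsHypothesis.ValiantsHypothesis.Theorems.BarrierLeverAnchoredDoorHitsLowerPairsDTSStep
import Summits.ValiantsHypothesis.ValiantsHypothesis.Theorems.BarrierLeverAnchoredDoorHitsLowerPairsIsoPairs
import Summits.ValiantsHypothesis.ValiantsHypothesis.Theorems.BarrierLeverAnchoredDoorHitsLowerPairsBase

/-!
# Support item `AnchoredDoorHitsLowerPairs` (stmt-ValiantsHypothesis-22510), line `anchored-peeling`: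
# CERTIFICATE KIT — finite bridge lemmas for DTS-tree certificates

Helper file (`--supports stmt-ValiantsHypothesis-22510`; cell valiant-natproofs, rung V4, 𝒟-side door (c); registered line
`Cruxes/AnchoredDoorHitsLowerPairs/Lines/anchored_peeling.lean` v10; prover seat val-np-p1 gen 18). Definition-free. Closes NO item.

A DTS-TREE CERTIFICATE for a concrete lower pair is a tree whose internal nodes are decomposing DT-stages (`DTPeel.symbolicDet_ne_zero_of_dtsStep`,
p603111) and whose leaves are the base pair `({∅},{∅})` or ISOMORPHIC pairs (`symbolicDet_ne_zero_of_perm_layout`, p604704); the «for every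
enumeration» hypotheses of a node are discharged from ONE enumeration of each sub-pair by re-enumeration invariance (`symbolicDet_ne_zero_of_range_eq`,
p605297) and the four RANGE BRIDGES of this file, whose hypotheses are finite statements over the index types (so `decide` proves them for data):
`range_eq_del_rows`, `range_eq_del_cols`, `range_eq_class_rows`, `range_eq_class_cols`; plus the base certificate `symbolicDet_base_ne_zero`.
Generator: HOME/val-np-p1/g18/lab/gencert.py (tree search lab/certtree.py: P_5 = 7 stages + 14 iso leaves; cube6/B(7,3) = 18 stages + 13 iso leaves).

WHAT THIS IS NOT: nothing on items 22510 / 19717 themselves, on crux stmt-ValiantsHypothesis-14610 or on `VP` versus `VNP`.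
-/

set_option linter.dupNamespace false

namespace Summit.ValiantsHypothesis.ValiantsHypothesis.Theorems.BarrierLever.AnchoredPeeling

open Finset MvPolynomial

noncomputable section

namespace DTPeel

variable {h : ℕ}

/-- Range bridge for the rows of a deletion pair. -/
theorem range_eq_del_rows {r r₀ : ℕ} (u : Fin r → Finset (Fin h)) (a : Fin h) (f : Fin r₀ → Finset (Fin h))
    (h1 : ∀ i, (∃ k, u k = f i) ∧ a ∉ f i) (h2 : ∀ k, a ∉ u k → ∃ i, f i = u k) :
    Set.range f = {S | S ∈ Set.range u ∧ a ∉ S} := by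
  ext S
  constructor
  · rintro ⟨i, rfl⟩
    exact ⟨(h1 i).1, (h1 i).2⟩
  · rintro ⟨⟨k, rfl⟩, hk⟩
    obtain ⟨i, hi⟩ := h2 k hk
    exact ⟨i, hi⟩

/-- Range bridge for the columns of a deletion pair. -/
theorem range_eq_del_cols {r r₀ J : ℕ} (w : Fin r → Finset (Fin h)) (E : Fin J → Finset (Fin h)) (g : Fin r₀ → Finset (Fin h))
    (h1 : ∀ i, (∃ k, w k = g i) ∧ ∀ j, ¬ E j ⊆ g i) (h2 : ∀ k, (∀ j, ¬ E j ⊆ w k) → ∃ i, g i = w k) :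
    Set.range g = {T | T ∈ Set.range w ∧ ∀ j, ¬ E j ⊆ T} := by
  ext T
  constructor
  · rintro ⟨i, rfl⟩
    exact ⟨(h1 i).1, (h1 i).2⟩
  · rintro ⟨⟨k, rfl⟩, hk⟩
    obtain ⟨i, hi⟩ := h2 k hk
    exact ⟨i, hi⟩

/-- Range bridge for the rows of a shifted class pair. -/
theorem range_eq_class_rows {r r₁ J : ℕ} (u : Fin r → Finset (Fin h)) (a : Fin h) (B : Fin J → Finset (Fin h)) (j : Fin J)
    (f : Fin r₁ → Finset (Fin h)) (haB : a ∉ B j)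
    (h1 : ∀ i, a ∉ f i ∧ Disjoint (f i) (B j) ∧ (∃ k, u k = insert a (f i ∪ B j)) ∧ ∀ j', j' < j → ¬ B j' ⊆ f i ∪ B j)
    (h2 : ∀ k, a ∈ u k → B j ⊆ (u k).erase a → (∀ j', j' < j → ¬ B j' ⊆ (u k).erase a) → ∃ i, f i = ((u k).erase a) \ B j) :
    Set.range f = {S | a ∉ S ∧ Disjoint S (B j) ∧ insert a (S ∪ B j) ∈ Set.range u ∧ ∀ j', j' < j → ¬ B j' ⊆ S ∪ B j} := by
  ext S
  constructor
  · rintro ⟨i, rfl⟩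
    obtain ⟨ha, hd, ⟨k, hk⟩, hm⟩ := h1 i
    exact ⟨ha, hd, ⟨k, hk⟩, hm⟩
  · rintro ⟨ha, hd, ⟨k, hk⟩, hm⟩
    have hak : a ∈ u k := by rw [hk]; exact Finset.mem_insert_self _ _
    have haSB : a ∉ S ∪ B j := by rw [Finset.mem_union, not_or]; exact ⟨ha, haB⟩
    have hera : (u k).erase a = S ∪ B j := by rw [hk, Finset.erase_insert haSB]
    obtain ⟨i, hi⟩ := h2 k hak (hera ▸ Finset.subset_union_right) (fun j' hj' hB => hm j' hj' (hera ▸ hB))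
    exact ⟨i, by rw [hi, hera, Finset.union_sdiff_cancel_right hd]⟩

/-- Range bridge for the columns of a shifted class pair. -/
theorem range_eq_class_cols {r r₁ J : ℕ} (w : Fin r → Finset (Fin h)) (E : Fin J → Finset (Fin h)) (j : Fin J)
    (g : Fin r₁ → Finset (Fin h))
    (h1 : ∀ i, Disjoint (g i) (E j) ∧ (∃ k, w k = g i ∪ E j) ∧ ∀ j', j' < j → ¬ E j' ⊆ g i ∪ E j)
    (h2 : ∀ k, E j ⊆ w k → (∀ j', j' < j → ¬ E j' ⊆ w k) → ∃ i, g i = w k \ E j) :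
    Set.range g = {T | Disjoint T (E j) ∧ T ∪ E j ∈ Set.range w ∧ ∀ j', j' < j → ¬ E j' ⊆ T ∪ E j} := by
  ext T
  constructor
  · rintro ⟨i, rfl⟩
    obtain ⟨hd, ⟨k, hk⟩, hm⟩ := h1 i
    exact ⟨hd, ⟨k, hk⟩, hm⟩
  · rintro ⟨hd, ⟨k, hk⟩, hm⟩
    obtain ⟨i, hi⟩ := h2 k (hk ▸ Finset.subset_union_right) (fun j' hj' hE => hm j' hj' (hk ▸ hE))
    exact ⟨i, by rw [hi, hk, Finset.union_sdiff_cancel_right hd]⟩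

/-- The base certificate: the pair `({∅}, {∅})`. -/
theorem symbolicDet_base_ne_zero (s h : ℕ) :
    symbolicDet s h 1 (fun _ => (∅ : Finset (Fin h))) (fun _ => (∅ : Finset (Fin h))) ≠ 0 := by
  have hl : IsLowerSet (Set.range (fun _ : Fin 1 => (∅ : Finset (Fin h)))) := by
    intro S T hTS hS
    obtain ⟨i, hi⟩ := hS
    refine ⟨i, ?_⟩
    have hS0 : S = ∅ := hi.symm
    rw [hS0] at hTS
    have hT0 : T = ∅ := Finset.subset_empty.mp hTS
    rw [hT0]
  have hinj : Function.Injective (fun _ : Fin 1 => (∅ : Finset (Fin h))) := fun i j _ => Subsingleton.elim i j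
  exact stub_base s h 1 _ _ hinj hinj hl hl le_rfl

end DTPeel

end

end Summit.ValiantsHypothesis.ValiantsHypothesis.Theorems.BarrierLever.AnchoredPeeling
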